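import Summits.Parity.BatemanHorn.Theorems.RoughValueTransportDefs
import Literature.NumberTheory.Sieve.PolynomialValuesSieveSequence
import Literature.NumberTheory.Sieve.PolynomialCongruencesLemmas
import HarnessLib

/-!
# Rough balanced-divisor window: the size of the weighted line (anchor B)

Route `RoughValueTransport`, crux `BalancedSemiprimeLayer` (item stmt-Parity-9469), line
`rough-relaxed-divisor-sieve` (companion lead c1): anchor B `stub_roughWindowRhoSum` of the
skeleton `Cruxes/BalancedSemiprimeLayer/Lines/rough_relaxed_divisor_sieve_c1.lean` (`--supports`).
The lever of the line sifts the weighted line `n ↦ #{m ∈ roughDivWindow d δ c x : m ∣ g(n)}`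
(`g = fᵢ` of degree `d`), of total mass `x·Σ_{m ∈ roughDivWindow d δ c x} ρ_g(m)/m` with
`ρ_g(m)/m = rootDensity g m` (multiplicative).  Proved here: eventually in `x`,
`Σ_{m ∈ roughDivWindow d δ c x} ρ_g(m)/m ≤ d²δ/c² + θ` for every `θ > 0`, GIVEN the Mertens-type
prime-window bound of anchor A as a hypothesis (`Σ_{u<p≤v} ρ_g(p)/p ≤ log(log v/log u) + θ₁`,
`u ≥ u₀(θ₁)`).  Elementary and definition-free: split `m = m'·p` at the least prime factor
(`sum_le_sum_mul_sum_of_minFac`, `window_decomp`); above a cofactor `m'` the prime `p` lies in a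
window of logarithmic length `≤ dδ log x + log 2` starting above `x^c/2` (`primeWindow_sum_le`);
the cofactors are squarefree and `x^c`-rough, so they sum to at most
`∏_{x^c<q≤B}(1 + ρ(q)/q) ≤ exp Σ_q ρ(q)/q ≤ e^{θ₁}(3d/4) log x/(c log x − log 2) ≤ d/c`
(`sum_squarefree_le_prod_one_add`, adapted from the tree's
`Literature.NumberTheory.LFunctions.SiegelZero.sum_squarefree_le_prod_one_add_sub_one`, and
`cofactor_sum_le`); finally `θ₁ = min(1/10, θc/(2d))`.
-/

noncomputable section

open Polynomial Filter Finset
open Literature.NumberTheory.Sieve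

namespace Summit.Parity.BatemanHorn.Cruxes.BalancedSemiprimeLayer.RoughRelaxedDivisorSieve

namespace RoughWindowRhoSum

/-! ### Two abstract inequalities for non-negative multiplicative functions -/

/-- For a non-negative multiplicative `h` and a finite set `S` of squarefree integers whose prime
factors lie in `Q`: `∑_{m ∈ S} h(m) ≤ ∏_{q ∈ Q} (1 + h(q))` (expand the product over the subsets
of `Q`; `m ↦ primeFactors m` is injective on squarefree numbers). [folklore] -/
theorem sum_squarefree_le_prod_one_add {h : ArithmeticFunction ℝ} (hmul : h.IsMultiplicative)
    (h0 : ∀ n, 0 ≤ h n) {Q S : Finset ℕ} (hS : ∀ m ∈ S, Squarefree m ∧ m.primeFactors ⊆ Q) :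
    ∑ m ∈ S, h m ≤ ∏ q ∈ Q, (1 + h q) := by
  classical
  -- adapted from the tree's
  -- `Literature.NumberTheory.LFunctions.SiegelZero.sum_squarefree_le_prod_one_add_sub_one`
  rw [prod_one_add]
  have hinj : Set.InjOn Nat.primeFactors (S : Set ℕ) := by
    intro m₁ h₁ m₂ h₂ heq
    rw [← Nat.prod_primeFactors_of_squarefree (hS m₁ h₁).1,
      ← Nat.prod_primeFactors_of_squarefree (hS m₂ h₂).1]
    exact congrArg (fun t : Finset ℕ => ∏ p ∈ t, p) heq
  have hsum : ∑ m ∈ S, h m = ∑ t ∈ S.image Nat.primeFactors, ∏ p ∈ t, h p := by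
    rw [sum_image hinj]
    exact sum_congr rfl fun m hm => (hmul.prod_primeFactors (hS m hm).1).symm
  rw [hsum]
  have hsub : S.image Nat.primeFactors ⊆ Q.powerset := by
    intro t ht
    obtain ⟨m, hm, rfl⟩ := mem_image.mp ht
    exact mem_powerset.mpr (hS m hm).2
  exact sum_le_sum_of_subset_of_nonneg hsub fun t _ _ => prod_nonneg fun p _ => h0 p

/-- `∏_{q ∈ Q} (1 + a(q)) ≤ exp(∑_{q ∈ Q} a(q))` for `a ≥ 0` on `Q`. [folklore] -/
theorem prod_one_add_le_exp_sum {ι : Type*} (s : Finset ι) {a : ι → ℝ} (ha : ∀ i ∈ s, 0 ≤ a i) :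
    ∏ i ∈ s, (1 + a i) ≤ Real.exp (∑ i ∈ s, a i) := by
  rw [Real.exp_sum]
  refine prod_le_prod (fun i hi => by linarith [ha i hi]) fun i _ => ?_
  linarith [Real.add_one_le_exp (a i)]

/-- **Decomposition by the least prime factor.**  For a non-negative multiplicative `h` and a
finite set `R` of squarefree integers: writing `m = m'·p`, `p = minFac m` (so `(m', p) = 1`,
`h(m) = h(m') h(p)`), if always `m' ∈ S` and `p ∈ T m'`, then
`∑_{m ∈ R} h(m) ≤ ∑_{m' ∈ S} h(m') ∑_{p ∈ T m'} h(p)` (`m ↦ (m', p)` is injective). [folklore] -/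
theorem sum_le_sum_mul_sum_of_minFac {h : ArithmeticFunction ℝ} (hmul : h.IsMultiplicative)
    (h0 : ∀ n, 0 ≤ h n) {R S : Finset ℕ} {T : ℕ → Finset ℕ}
    (hR : ∀ m ∈ R, Squarefree m ∧ m / m.minFac ∈ S ∧ m.minFac ∈ T (m / m.minFac)) :
    ∑ m ∈ R, h m ≤ ∑ m' ∈ S, h m' * ∑ p ∈ T m', h p := by
  classical
  have hdecomp : ∀ m ∈ R, h m = h (m / m.minFac) * h m.minFac := by
    intro m hm
    have hprod : m / m.minFac * m.minFac = m := Nat.div_mul_cancel (Nat.minFac_dvd m)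
    have hsq : Squarefree (m / m.minFac * m.minFac) := by rw [hprod]; exact (hR m hm).1
    conv_lhs => rw [← hprod]
    exact hmul.map_mul_of_coprime (Nat.squarefree_mul_iff.mp hsq).1
  set φ : ℕ → (Σ _ : ℕ, ℕ) := fun m => ⟨m / m.minFac, m.minFac⟩ with hφ
  have hinj : Set.InjOn φ (R : Set ℕ) := by
    intro m₁ _ m₂ _ heq
    simp only [hφ, Sigma.mk.injEq, heq_eq_eq] at heq
    rw [← Nat.div_mul_cancel (Nat.minFac_dvd m₁), ← Nat.div_mul_cancel (Nat.minFac_dvd m₂),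
      heq.1, heq.2]
  have himg : R.image φ ⊆ S.sigma T := by
    intro y hy
    obtain ⟨m, hm, rfl⟩ := mem_image.mp hy
    exact mem_sigma.mpr ⟨(hR m hm).2.1, (hR m hm).2.2⟩
  calc ∑ m ∈ R, h m = ∑ m ∈ R, (fun y : (Σ _ : ℕ, ℕ) => h y.1 * h y.2) (φ m) :=
        sum_congr rfl hdecomp
    _ = ∑ y ∈ R.image φ, h y.1 * h y.2 :=
        (sum_image (f := fun y : (Σ _ : ℕ, ℕ) => h y.1 * h y.2) hinj).symm
    _ ≤ ∑ y ∈ S.sigma T, h y.1 * h y.2 :=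
        sum_le_sum_of_subset_of_nonneg himg fun y _ _ => mul_nonneg (h0 _) (h0 _)
    _ = ∑ m' ∈ S, ∑ p ∈ T m', h m' * h p := sum_sigma _ _ _
    _ = ∑ m' ∈ S, h m' * ∑ p ∈ T m', h p := by simp_rw [mul_sum]

/-! ### The window bookkeeping at a fixed height -/

/-- **Decomposition of a rough squarefree window modulus by its least prime factor.**  Let
`1 < A`, `0 ≤ z`, and let `m` be squarefree with `⌈A⌉ ≤ m ≤ ⌊B⌋` and every prime divisor `> z`.
Then `p = minFac m` is a prime in `(max(⌊z⌋, ⌈A/m'⌉ − 1), ⌊B/m'⌋]` and the cofactor `m' = m/p`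
is a squarefree `z`-rough integer in `[1, ⌊B⌋]`. [folklore] -/
theorem window_decomp {A B z : ℝ} (hA : 1 < A) (hz : 0 ≤ z) {m : ℕ} (hAm : ⌈A⌉₊ ≤ m)
    (hmB : m ≤ ⌊B⌋₊) (hsq : Squarefree m) (hrough : ∀ p : ℕ, p.Prime → p ∣ m → z < (p : ℝ)) :
    Squarefree m ∧
      m / m.minFac ∈ (Icc 1 ⌊B⌋₊).filter
          (fun n : ℕ => Squarefree n ∧ ∀ p ∈ n.primeFactors, z < (p : ℝ)) ∧
      m.minFac ∈ (Ioc (max ⌊z⌋₊ (⌈A / ↑(m / m.minFac)⌉₊ - 1)) ⌊B / ↑(m / m.minFac)⌋₊).filter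
          Nat.Prime := by
  have hAm' : A ≤ m := Nat.ceil_le.mp hAm
  have hm1 : 1 < m := by exact_mod_cast hA.trans_le hAm'
  have hm0 : m ≠ 0 := by omega
  have hp : m.minFac.Prime := Nat.minFac_prime (by omega)
  have hpm : m.minFac ∣ m := Nat.minFac_dvd m
  set p := m.minFac with hp_def
  set m' := m / p with hm'_def
  have hprod : m' * p = m := Nat.div_mul_cancel hpm
  have hm'pos : 0 < m' := Nat.pos_of_ne_zero fun h => hm0 (by rw [← hprod, h, zero_mul])
  have hm'posR : (0 : ℝ) < m' := by exact_mod_cast hm'pos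
  have hprodR : (m' : ℝ) * p = m := by exact_mod_cast hprod
  have hm'dvd : m' ∣ m := Nat.div_dvd_of_dvd hpm
  have hmB' : (m : ℝ) ≤ B := (Nat.le_floor_iff' hm0).mp hmB
  refine ⟨hsq, ?_, ?_⟩
  · refine mem_filter.mpr ⟨mem_Icc.mpr ⟨hm'pos, (Nat.div_le_self m p).trans hmB⟩,
      hsq.squarefree_of_dvd hm'dvd, fun q hq => ?_⟩
    have hq' := Nat.mem_primeFactors.mp (Nat.primeFactors_mono hm'dvd hm0 hq)
    exact hrough q hq'.1 hq'.2.1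
  · refine mem_filter.mpr ⟨mem_Ioc.mpr ⟨max_lt ?_ ?_, ?_⟩, hp⟩
    · exact (Nat.floor_lt hz).mpr (hrough p hp hpm)
    · have h1 : ⌈A / m'⌉₊ ≤ p := by
        refine Nat.ceil_le.mpr ?_
        rw [div_le_iff₀ hm'posR, mul_comm, hprodR]
        exact hAm'
      have h2 := hp.two_le
      omega
    · refine Nat.le_floor ?_
      rw [le_div_iff₀ hm'posR, mul_comm, hprodR]
      exact hmB'

/-- **The prime window above a cofactor** (uses the Mertens-type hypothesis with tolerance `θ₁`
from `u₀` on).  For `0 < A ≤ B`, `2 < z`, `u₀ ≤ z` and `m' ≥ 1`: the sum of `ρ(p)/p` over the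
primes `max(⌊z⌋, ⌈A/m'⌉ − 1) < p ≤ ⌊B/m'⌋` is `≤ (log B − log A + log 2)/(log z − log 2) + θ₁`
(`log(log v/log u) ≤ log v/log u − 1`, `log v − log u ≤ log(B/A) + log 2`, `log u ≥ log(z/2)`).
[folklore] -/
theorem primeWindow_sum_le {g : ℤ[X]} {θ₁ : ℝ} {u₀ : ℕ}
    (H : ∀ u v : ℕ, u₀ ≤ u → u ≤ v →
      (∑ p ∈ (Ioc u v).filter Nat.Prime, (polyRootCountMod ![g] p : ℝ) / p) ≤
        Real.log (Real.log v / Real.log u) + θ₁)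
    (hθ₁ : 0 ≤ θ₁) {A B z : ℝ} (hA : 0 < A) (hAB : A ≤ B) (hz : 2 < z) (hu₀ : (u₀ : ℝ) ≤ z)
    {m' : ℕ} (hm' : 1 ≤ m') :
    (∑ p ∈ (Ioc (max ⌊z⌋₊ (⌈A / m'⌉₊ - 1)) ⌊B / m'⌋₊).filter Nat.Prime, rootDensity g p) ≤
      (Real.log B - Real.log A + Real.log 2) / (Real.log z - Real.log 2) + θ₁ := by
  set u : ℕ := max ⌊z⌋₊ (⌈A / m'⌉₊ - 1) with hu_def
  set v : ℕ := ⌊B / m'⌋₊ with hv_def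
  have hm'pos : (0 : ℝ) < m' := by exact_mod_cast hm'
  have hB : 0 < B := hA.trans_le hAB
  have hlog2z : Real.log z - Real.log 2 = Real.log (z / 2) :=
    (Real.log_div (by linarith) (by norm_num)).symm
  have hlogz2 : 0 < Real.log z - Real.log 2 := by
    rw [hlog2z]; exact Real.log_pos (by linarith)
  have hnum : 0 ≤ Real.log B - Real.log A + Real.log 2 := by
    linarith [Real.log_le_log hA hAB, Real.log_pos (one_lt_two : (1 : ℝ) < 2)]
  have hu_z : (⌊z⌋₊ : ℝ) ≤ u := by exact_mod_cast le_max_left _ _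
  have hu_A : A / m' - 1 ≤ u := by
    have h1 : A / m' ≤ ⌈A / m'⌉₊ := Nat.le_ceil _
    have h2 : (⌈A / m'⌉₊ : ℕ) ≤ (⌈A / m'⌉₊ - 1) + 1 := le_tsub_add
    have h3 : ((⌈A / m'⌉₊ - 1 : ℕ) : ℝ) ≤ u := by exact_mod_cast le_max_right _ _
    have h2' : (⌈A / m'⌉₊ : ℝ) ≤ ((⌈A / m'⌉₊ - 1 : ℕ) : ℝ) + 1 := by exact_mod_cast h2
    linarith
  have hzfloor : z < ⌊z⌋₊ + 1 := Nat.lt_floor_add_one z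
  have hu_half_z : z / 2 ≤ u := by linarith
  have hu_pos : (0 : ℝ) < u := by linarith
  have hlogu : Real.log z - Real.log 2 ≤ Real.log u := by
    rw [hlog2z]; exact Real.log_le_log (by linarith) hu_half_z
  have hlogu_pos : 0 < Real.log u := hlogz2.trans_le hlogu
  have hlogu' : Real.log A - Real.log m' - Real.log 2 ≤ Real.log u := by
    have h2u : A / m' / 2 ≤ u := by linarith
    have hpos : 0 < A / m' / 2 := by positivity
    have := Real.log_le_log hpos h2u
    rw [Real.log_div (by positivity) (by norm_num), Real.log_div hA.ne' hm'pos.ne'] at this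
    linarith
  rcases lt_or_ge v u with hvu | huv
  · have he : Ioc u v = ∅ := Finset.Ioc_eq_empty (not_lt.mpr hvu.le)
    rw [he, Finset.filter_empty, Finset.sum_empty]
    exact add_nonneg (div_nonneg hnum hlogz2.le) hθ₁
  · have hu₀u : u₀ ≤ u := (Nat.le_floor hu₀).trans (le_max_left _ _)
    have hH : (∑ p ∈ (Ioc u v).filter Nat.Prime, rootDensity g p) ≤
        Real.log (Real.log v / Real.log u) + θ₁ := H u v hu₀u huv
    refine hH.trans (add_le_add ?_ le_rfl)
    have hv_ge : (u : ℝ) ≤ v := by exact_mod_cast huv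
    have hv_pos : (0 : ℝ) < v := hu_pos.trans_le hv_ge
    have hlogv : Real.log v ≤ Real.log B - Real.log m' := by
      rw [← Real.log_div hB.ne' hm'pos.ne']
      exact Real.log_le_log hv_pos (Nat.floor_le (div_nonneg hB.le hm'pos.le))
    have hloguv : Real.log u ≤ Real.log v := Real.log_le_log hu_pos hv_ge
    have hratio_pos : 0 < Real.log v / Real.log u := div_pos (hlogu_pos.trans_le hloguv) hlogu_pos
    calc Real.log (Real.log v / Real.log u)
        ≤ Real.log v / Real.log u - 1 := Real.log_le_sub_one_of_pos hratio_pos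
      _ = (Real.log v - Real.log u) / Real.log u := by rw [div_sub_one hlogu_pos.ne']
      _ ≤ (Real.log B - Real.log A + Real.log 2) / Real.log u :=
          div_le_div_of_nonneg_right (by linarith) hlogu_pos.le
      _ ≤ (Real.log B - Real.log A + Real.log 2) / (Real.log z - Real.log 2) :=
          div_le_div_of_nonneg_left hnum hlogz2 hlogu

/-- **The cofactor sum** (uses the Mertens-type hypothesis once, on `(⌊z⌋, ⌊B⌋]`).  For `2 < z`,
`u₀ ≤ z`, `1 ≤ K` and `e^{θ₁}·log B/(log z − log 2) ≤ K`: the sum of `ρ(m')/m'` over the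
squarefree `z`-rough `1 ≤ m' ≤ ⌊B⌋` is `≤ K`
(`≤ ∏_{⌊z⌋ < q ≤ ⌊B⌋, q prime} (1 + ρ(q)/q) ≤ exp(∑ ρ(q)/q) ≤ e^{θ₁} log⌊B⌋/log⌊z⌋`). [folklore] -/
theorem cofactor_sum_le {g : ℤ[X]} {θ₁ : ℝ} {u₀ : ℕ}
    (H : ∀ u v : ℕ, u₀ ≤ u → u ≤ v →
      (∑ p ∈ (Ioc u v).filter Nat.Prime, (polyRootCountMod ![g] p : ℝ) / p) ≤
        Real.log (Real.log v / Real.log u) + θ₁)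
    {B z K : ℝ} (hz : 2 < z) (hu₀ : (u₀ : ℝ) ≤ z) (hK : 1 ≤ K)
    (hK' : Real.exp θ₁ * Real.log B / (Real.log z - Real.log 2) ≤ K) :
    (∑ m ∈ (Icc 1 ⌊B⌋₊).filter (fun n : ℕ => Squarefree n ∧ ∀ p ∈ n.primeFactors, z < (p : ℝ)),
      rootDensity g m) ≤ K := by
  set Q : Finset ℕ := (Ioc ⌊z⌋₊ ⌊B⌋₊).filter Nat.Prime with hQ
  have hz0 : 0 ≤ z := by linarith
  have hS : ∀ m ∈ (Icc 1 ⌊B⌋₊).filter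
      (fun n : ℕ => Squarefree n ∧ ∀ p ∈ n.primeFactors, z < (p : ℝ)),
      Squarefree m ∧ m.primeFactors ⊆ Q := by
    intro m hm
    rw [mem_filter, mem_Icc] at hm
    obtain ⟨⟨-, hmB⟩, hsq, hrough⟩ := hm
    refine ⟨hsq, fun p hp => ?_⟩
    have hp' := Nat.mem_primeFactors.mp hp
    rw [hQ, mem_filter, mem_Ioc]
    exact ⟨⟨(Nat.floor_lt hz0).mpr (hrough p hp), (Nat.le_of_dvd (by omega) hp'.2.1).trans hmB⟩,
      hp'.1⟩
  refine (sum_squarefree_le_prod_one_add (isMultiplicative_rootDensity g) (rootDensity_nonneg g)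
    hS).trans ((prod_one_add_le_exp_sum Q fun q _ => rootDensity_nonneg g q).trans ?_)
  rcases lt_or_ge ⌊B⌋₊ ⌊z⌋₊ with hlt | hle
  · have he : Q = ∅ := by
      rw [hQ, Finset.Ioc_eq_empty (not_lt.mpr hlt.le), Finset.filter_empty]
    rw [he, sum_empty, Real.exp_zero]
    exact hK
  · have hH : (∑ q ∈ Q, rootDensity g q) ≤
        Real.log (Real.log (⌊B⌋₊ : ℕ) / Real.log (⌊z⌋₊ : ℕ)) + θ₁ :=
      H ⌊z⌋₊ ⌊B⌋₊ (Nat.le_floor hu₀) hle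
    have hzfl : z / 2 ≤ ⌊z⌋₊ := by linarith [Nat.lt_floor_add_one z]
    have hlog2z : Real.log z - Real.log 2 = Real.log (z / 2) :=
      (Real.log_div (by linarith) (by norm_num)).symm
    have hlogz2 : 0 < Real.log z - Real.log 2 := by
      rw [hlog2z]; exact Real.log_pos (by linarith)
    have hlogfz : Real.log z - Real.log 2 ≤ Real.log ⌊z⌋₊ := by
      rw [hlog2z]; exact Real.log_le_log (by linarith) hzfl
    have hBf : (⌊z⌋₊ : ℝ) ≤ ⌊B⌋₊ := by exact_mod_cast hle
    have hBfpos : (0 : ℝ) < ⌊B⌋₊ := by linarith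
    have hB0 : 0 ≤ B := zero_le_one.trans (Nat.floor_pos.mp (Nat.cast_pos.mp hBfpos))
    have hlogfB : Real.log ⌊B⌋₊ ≤ Real.log B := Real.log_le_log hBfpos (Nat.floor_le hB0)
    have hlogfB_pos : 0 < Real.log ⌊B⌋₊ := Real.log_pos (by linarith)
    have hlogfz_pos : 0 < Real.log ⌊z⌋₊ := hlogz2.trans_le hlogfz
    have hratio : 0 < Real.log ⌊B⌋₊ / Real.log ⌊z⌋₊ := div_pos hlogfB_pos hlogfz_pos
    have hlogB : 0 ≤ Real.log B := hlogfB_pos.le.trans hlogfB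
    calc Real.exp (∑ q ∈ Q, rootDensity g q)
        ≤ Real.exp (Real.log (Real.log ⌊B⌋₊ / Real.log ⌊z⌋₊) + θ₁) := Real.exp_le_exp.mpr hH
      _ = Real.log ⌊B⌋₊ / Real.log ⌊z⌋₊ * Real.exp θ₁ := by
          rw [Real.exp_add, Real.exp_log hratio]
      _ ≤ Real.log B / (Real.log z - Real.log 2) * Real.exp θ₁ :=
          mul_le_mul_of_nonneg_right (div_le_div₀ hlogB hlogfB hlogz2 hlogfz)
            (Real.exp_pos _).le
      _ = Real.exp θ₁ * Real.log B / (Real.log z - Real.log 2) := by ring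
      _ ≤ K := hK'

end RoughWindowRhoSum

open RoughWindowRhoSum in
/-- **Anchor B `stub_roughWindowRhoSum`** — the size of the weighted line: given the prime-window
bound of anchor A (as a hypothesis), for `1 ≤ d`, `0 < c ≤ 1`, `0 < δ ≤ 1/2`, `θ > 0`, eventually
`Σ_{m ∈ roughDivWindow d δ c x} ρ_g(m)/m ≤ d²δ/c² + θ`.
Proof: `m = m'·p`, `p = minFac m`; given `m'` the prime `p > x^c` ranges in
`(max(x^c, A/m') − 1, B/m']` (`A = x^{d(1−δ)/2}`, `B = x^{d(1+δ)/2}`), contributing at most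
`(dδ log x + log 2)/(c log x − log 2) + θ₁` by the hypothesis (`primeWindow_sum_le`); the cofactors
contribute `Σ_{m'} ρ(m')/m' ≤ e^{θ₁}·(3d/4) log x/(c log x − log 2) ≤ d/c` (`cofactor_sum_le`, with
`θ₁ ≤ 1/10`, `c log x ≥ 6 log 2`); finally `θ₁ ≤ θc/(2d)` and `x` large. [folklore] -/
theorem stub_roughWindowRhoSum :
    ∀ (g : ℤ[X]),
      (∀ θ : ℝ, 0 < θ → ∃ u₀ : ℕ, ∀ u v : ℕ, u₀ ≤ u → u ≤ v →
        (∑ p ∈ (Ioc u v).filter Nat.Prime, (polyRootCountMod ![g] p : ℝ) / p) ≤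
          Real.log (Real.log v / Real.log u) + θ) →
      ∀ (d : ℕ) (c δ θ : ℝ), 1 ≤ d → 0 < c → c ≤ 1 → 0 < δ → δ ≤ 1 / 2 → 0 < θ →
        ∀ᶠ x : ℕ in atTop,
          (∑ m ∈ roughDivWindow d δ c x, (polyRootCountMod ![g] m : ℝ) / m) ≤
            (d : ℝ) ^ 2 * δ / c ^ 2 + θ := by
  intro g H d c δ θ hd hc hc1 hδ hδ2 hθ
  have hd' : (1 : ℝ) ≤ d := by exact_mod_cast hd
  have hdpos : (0 : ℝ) < d := by linarith
  have hlog2 : 0 < Real.log 2 := Real.log_pos one_lt_two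
  -- the auxiliary tolerance `θ₁` and the threshold `u₀` of the hypothesis
  obtain ⟨θ₁, hθ₁pos, hθ₁a, hθ₁b⟩ : ∃ θ₁ : ℝ, 0 < θ₁ ∧ θ₁ ≤ 1 / 10 ∧ θ₁ ≤ θ * c / (2 * d) :=
    ⟨min (1 / 10) (θ * c / (2 * d)), lt_min (by norm_num) (by positivity), min_le_left _ _,
      min_le_right _ _⟩
  obtain ⟨u₀, hu₀⟩ := H θ₁ hθ₁pos
  -- the finitely many "x large" conditions
  have hM : Tendsto (fun x : ℕ => c * Real.log (x : ℝ) - Real.log 2) atTop atTop := by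
    simpa only [← sub_eq_add_neg, Function.comp_def] using tendsto_atTop_add_const_right _
      (-Real.log 2) ((Real.tendsto_log_atTop.comp tendsto_natCast_atTop_atTop).const_mul_atTop hc)
  have hzt : Tendsto (fun x : ℕ => (x : ℝ) ^ c) atTop atTop :=
    (tendsto_rpow_atTop hc).comp tendsto_natCast_atTop_atTop
  have hKt : Tendsto (fun x : ℕ => ((d : ℝ) * δ * Real.log 2 / c + Real.log 2) /
      (c * Real.log (x : ℝ) - Real.log 2)) atTop (nhds 0) :=
    tendsto_const_nhds.div_atTop hM
  filter_upwards [eventually_ge_atTop 2, hzt.eventually_ge_atTop (max (u₀ : ℝ) 3),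
    hM.eventually_ge_atTop (5 * Real.log 2),
    hKt.eventually_le_const (show (0 : ℝ) < θ * c / (2 * d) by positivity)]
    with x hx2 hzx hMx hKx
  -- notation and elementary facts at the fixed height `x`
  set L : ℝ := Real.log (x : ℝ) with hL
  set z : ℝ := (x : ℝ) ^ c with hz
  set A : ℝ := (x : ℝ) ^ ((d : ℝ) * (1 - δ) / 2) with hA
  set B : ℝ := (x : ℝ) ^ ((d : ℝ) * (1 + δ) / 2) with hB
  have hx1 : (1 : ℝ) < x := by exact_mod_cast hx2
  have hx0 : (0 : ℝ) < x := by linarith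
  have hL0 : 0 < L := Real.log_pos hx1
  have hMpos : 0 < c * L - Real.log 2 := by linarith
  have hzlog : Real.log z = c * L := Real.log_rpow hx0 c
  have hAlog : Real.log A = (d : ℝ) * (1 - δ) / 2 * L := Real.log_rpow hx0 _
  have hBlog : Real.log B = (d : ℝ) * (1 + δ) / 2 * L := Real.log_rpow hx0 _
  have he₁ : 0 < (d : ℝ) * (1 - δ) / 2 := by nlinarith
  have hA1 : 1 < A := Real.one_lt_rpow hx1 he₁
  have hApos : 0 < A := by linarith
  have hAB : A ≤ B := Real.rpow_le_rpow_of_exponent_le hx1.le (by nlinarith)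
  have hz2 : 2 < z := by linarith [(le_max_right _ _).trans hzx]
  have hu₀z : (u₀ : ℝ) ≤ z := (le_max_left _ _).trans hzx
  have hz0 : 0 ≤ z := by linarith
  set S : Finset ℕ := (Icc 1 ⌊B⌋₊).filter
    (fun n : ℕ => Squarefree n ∧ ∀ p ∈ n.primeFactors, z < (p : ℝ)) with hS
  set T : ℕ → Finset ℕ := fun m' =>
    (Ioc (max ⌊z⌋₊ (⌈A / m'⌉₊ - 1)) ⌊B / m'⌋₊).filter Nat.Prime with hT
  set W : ℝ := (Real.log B - Real.log A + Real.log 2) / (Real.log z - Real.log 2) + θ₁ with hW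
  -- Step 1: decomposition by the least prime factor
  have step1 : (∑ m ∈ roughDivWindow d δ c x, rootDensity g m) ≤
      ∑ m' ∈ S, rootDensity g m' * ∑ p ∈ T m', rootDensity g p := by
    refine sum_le_sum_mul_sum_of_minFac (isMultiplicative_rootDensity g) (rootDensity_nonneg g)
      fun m hm => ?_
    obtain ⟨hmw, hsq, hrough⟩ := mem_roughDivWindow.mp hm
    obtain ⟨hAm, hmB⟩ := mem_Icc.mp hmw
    exact window_decomp hA1 hz0 hAm hmB hsq hrough
  -- Step 2: every prime window contributes at most `W`
  have step2 : ∀ m' ∈ S, (∑ p ∈ T m', rootDensity g p) ≤ W := by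
    intro m' hm'
    have hm'1 : 1 ≤ m' := (mem_Icc.mp (mem_filter.mp hm').1).1
    exact primeWindow_sum_le hu₀ hθ₁pos.le hApos hAB hz2 hu₀z hm'1
  -- Step 3: the cofactor sum is at most `d/c`
  have hexp : Real.exp θ₁ ≤ 10 / 9 := by
    refine (Real.exp_bound_div_one_sub_of_interval hθ₁pos.le (by linarith)).trans ?_
    rw [div_le_div_iff₀ (by linarith) (by norm_num)]
    linarith
  have step3 : (∑ m' ∈ S, rootDensity g m') ≤ d / c := by
    refine cofactor_sum_le hu₀ hz2 hu₀z ((one_le_div hc).mpr (hc1.trans hd')) ?_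
    rw [hBlog, hzlog, div_le_div_iff₀ hMpos hc]
    have hδd : (d : ℝ) * δ ≤ d * (1 / 2) := mul_le_mul_of_nonneg_left hδ2 hdpos.le
    have h1 : Real.exp θ₁ * ((d : ℝ) * (1 + δ) / 2 * L) ≤ 10 / 9 * (3 * d / 4 * L) :=
      mul_le_mul hexp (mul_le_mul_of_nonneg_right (by linarith) hL0.le) (by positivity)
        (by norm_num)
    have h2 : (d : ℝ) * (5 * Real.log 2) ≤ d * (c * L - Real.log 2) :=
      mul_le_mul_of_nonneg_left hMx hdpos.le
    nlinarith
  -- Step 4: the value of `W` and the assembly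
  have hWval : W = d * δ / c +
      (((d : ℝ) * δ * Real.log 2 / c + Real.log 2) / (c * L - Real.log 2) + θ₁) := by
    have hM0 : c * L - Real.log 2 ≠ 0 := hMpos.ne'
    have hc0 : c ≠ 0 := hc.ne'
    have hnum : (d : ℝ) * (1 + δ) / 2 * L - (d : ℝ) * (1 - δ) / 2 * L + Real.log 2 =
        d * δ / c * (c * L - Real.log 2) + ((d : ℝ) * δ * Real.log 2 / c + Real.log 2) := by
      field_simp
      ring
    rw [hW, hAlog, hBlog, hzlog, hnum, add_div, mul_div_cancel_right₀ _ hM0, add_assoc]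
  have hW0 : 0 ≤ W := by rw [hWval]; positivity
  have hfinal : d / c * W ≤ (d : ℝ) ^ 2 * δ / c ^ 2 + θ := by
    have h1 : (d : ℝ) / c * (d * δ / c) = (d : ℝ) ^ 2 * δ / c ^ 2 := by ring
    have h2 : (d : ℝ) / c * (((d : ℝ) * δ * Real.log 2 / c + Real.log 2) / (c * L - Real.log 2)
        + θ₁) ≤ d / c * (θ * c / (2 * d) + θ * c / (2 * d)) :=
      mul_le_mul_of_nonneg_left (add_le_add hKx hθ₁b) (by positivity)
    have h3 : (d : ℝ) / c * (θ * c / (2 * d) + θ * c / (2 * d)) = θ := by field_simp; ring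
    rw [hWval, mul_add, h1]
    linarith
  calc (∑ m ∈ roughDivWindow d δ c x, (polyRootCountMod ![g] m : ℝ) / m)
      ≤ ∑ m' ∈ S, rootDensity g m' * ∑ p ∈ T m', rootDensity g p := step1
    _ ≤ ∑ m' ∈ S, rootDensity g m' * W :=
        sum_le_sum fun m' hm' => mul_le_mul_of_nonneg_left (step2 m' hm') (rootDensity_nonneg g m')
    _ = (∑ m' ∈ S, rootDensity g m') * W := (sum_mul _ _ _).symm
    _ ≤ d / c * W := mul_le_mul_of_nonneg_right step3 hW0
    _ ≤ (d : ℝ) ^ 2 * δ / c ^ 2 + θ := hfinal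

end Summit.Parity.BatemanHorn.Cruxes.BalancedSemiprimeLayer.RoughRelaxedDivisorSieve
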